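import Summits.ABC.IUTFork.Conditional.Layer5OfSV02
import Literature.IUT.HodgeTheaters.GlobalFrobenioidsCoricRigidityGenuineKummer
import Literature.IUT.HodgeTheaters.TemperedCoveringsCor23ReducedOfSpecialFibre
import Literature.IUT.HodgeTheaters.StableCurveTemperedDataOfSpecialFibreWholeGraph
import HarnessLib

/-!
# Layer-5 certificate, ADDITIVE PART v0.3 — [IUTchI] Ex 5.1 (v) law (a) DISCHARGED at the genuine Kummer map;
# §2 held rows at print's parameter `Π̂_ℍ := closure(Π^tp_ℍ)` (director-abc (C2); plan/L5/LAYER5-CERT-SPEC.md §7; writer abc-iut-L5-d1 gen 5)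

cert L5 v0.3 additive part (one slim module, PROOF-ONLY: no `def`, no `instance`, no `axiom`, no `sorry`, no `notation`; every input BY
NAME; nothing of v0 (p430789), the companion (p430066), v0.1 (p431142) or v0.2 (p433973, `Conditional/Layer5OfSV02.lean`) is touched).
TWO held blocks restated with WEAKER binder sets and ONE non-vacuity conjunct, then the single top of record `layer5_of_S_v3`
(scope = abc-iut-L5-lead gen 5 RULINGS #44 (2): GO (i)+(ii) + optional (iii)):

* (i) `layer5_held_ex51v_v3` — [IUTchI] Ex 5.1 (v) (abc-iut-L5-lead gen 4 GO 07:39:57Z item (d); recommended for conjunct 1 by the author of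
  record abc-iut-w5-d110, INBOX 08:15:05Z (2)): the NINE closed conjuncts of v0.2's `layer5_held_ex51v_v2` with conjunct 1 (E51/L29, ∞κ:
  «unique up to a uniquely determined isomorphism») RE-POINTED to abc-iut-w4-d056's
  `NFBridgeRecon.existsUniqueCoricStructure_infκPair_kummerMap` (p432037, over abc-iut-w5-d110's F-2571-free `…_of_fixedDivisors` p431147
  and abc-iut-w4-d056's law-(a) theorem `infκPair_exists_zhatTwist_kummerMap_iso`, p431351): the Kummer realisation of the ∞κ-pair is
  INTERNAL and GENUINE — L2's `kummerMap` into `lim_{→ i} H¹(S i, Λ(K_rat^×))` with its natural `π₁^rat`- and `Ẑ^×`-actions — so that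
  **the law binder `h_Ex51v_nat` (Kummer naturality (a) for the ∞κ-pair) DISAPPEARS: it is now a THEOREM at the genuine object**; in
  its place the printed INJECTIVITY of the Kummer map `h_Ex51v_inj` (E51/L26 «the asserted injectivity», a law: Kummer theory of the
  function fields) and five STRUCTURAL side conditions of the genuine Kummer lane (`hcoe` units action compatible with the field
  action · `hprim` roots of unity of every order in `K_rat` · `hc` the level system exhausts `K_rat^×` · `h1 : 1 ∈ 𝕄^⊛_∞κ` ·
  `hpow : f ∈ 𝕄^⊛_∞κ ⇔ fⁿ ∈ 𝕄^⊛_∞κ`, Rmk 3.1.7 (ii) = the definition of ∞κ-coric); `h_Ex51v_ord` is read at the genuine Kummer classes.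
  The datum `N` is taken in universe 0 (the L2 Kummer lane — Mathlib group cohomology — is single-universe); the abstract container
  `H`/`κ`/`κx` stays as DATA for conjuncts 2, 7 and 9.  Everything else verbatim as v0.2 (conjunct 9 = abc-iut-w5-d110's E51/L31 text
  4e919baf55567098).  WEAKENS v0.2 conjunct `StatementOf @layer5_held_ex51v_v2`: same 9 closed conjuncts; LAW 21 → 21 with `h_Ex51v_nat`
  (an instance law at the L2 merge) REPLACED by `h_Ex51v_inj` (a printed claim of Ex 5.1 (v) itself); FACT 0; structural side conditions +5.
* (ii) `layer5_held_sec2_v3_closureH` — [IUTchI] §2 held rows AT PRINT'S PARAMETER (abc-iut-w4-d058 INBOX 08:16:17Z (B)): the conjuncts of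
  v0.2's `layer5_held_sec2_v2` at the genuine 𝔛-datum `StableCurveTemperedData.ofSpecialFibre …` with the bare parameter `Π̂_ℍ` FIXED to
  the closure of `Π^tp_ℍ` in `Π̂_𝔾` — print's `Π̂_ℋ` (p.44 l.39–44: the pro-`Σ̂` fundamental group of `ℋ`, a compact group containing
  `Π^tp_ℋ` densely, regarded as a subgroup of `Π̂_𝒢`) IS that closure — so that the density binder `hH` is DEFINITIONAL and the data `HatH`,
  `hle` disappear; closer abc-iut-w4-d058's `StableCurveTemperedData.cor23_i_to_iv_ofSpecialFibre_reduced_closureH` (p431767, module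
  `TemperedCoveringsCor23ReducedOfSpecialFibre`; `hker` discharged inside, p431082) for (i)–(iv), the (v)/(vi)/Cor 2.5/Prop 2.4 (iii) closers
  of record at the same datum.  Law binders: h22 · hOutTp · hA' · hB' · hv · htp · hhat · h24i · h24ii = 9 (v0.2: 10; v0.1: 11; v0: 13).
  WEAKENS v0.2 conjunct `StatementOf @layer5_held_sec2_v2` by SPECIALISING the free parameter `HatH` to print's value (every other datum
  parameter stays free); the general-parameter form remains available in v0.2.
* (iii) `layer5_nv_sec2_wholeGraph` — NON-VACUITY conjunct (abc-iut-L5-lead gen 5 RULINGS #44 (2)(iii), «§2 binder set jointly realisable at the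
  genuine datum, ℍ = 𝔾, modulo 3 named binders» — NOT a discharge): in the instance `ℍ := 𝔾` (`Π^tp_ℍ := ⊤`, `Π̂_ℍ := ⊤`, every cusp meets
  `ℍ`) all PARAMETER binders of the §2 block are theorems (abc-iut-w4-d055, p433082) and the whole §2 conjunct list holds from `hslim`
  («`Δ̂_X` slim» given the Cor 2.3 hypotheses), `h24i`, `h24ii`; closer `StableCurveTemperedData.whole_graph_sec2_of_slim`.  Counted as NV 3,
  outside the CONE census (the general-`ℍ` conjuncts keep their own binders).
* BANKED, not in v0.3: abc-iut-w4-d058 (C) `…_of_graphStable` (p431985) — `hOutTp` ↦ the printed «ℍ is stabilized by the natural action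
  of G_k on 𝔾» (p.47 l.25–26) in group form `hHstab` + (P0)₀ `hK0` (G-w4d063-1), count unchanged (lead: not ordered for v0.3);
  abc-iut-L5-t11's (r2) `h24i`/`h24ii` reductions (p427758 review-pending).

CENSUS v0.3 (BINDER CONVENTION of RULINGS #40 (1)): most-reduced routes — sec2_v3_closureH 9 · sec6 1 · prop67 1 · cor56i_ref 7 · cor12 6 ·
ex51v_v3 21 · ex51i_L11 1 = **CONE 46 · FACT 0** · datum side-conditions 8 + 5 (genuine Kummer lane) = 13 · NV 3 (`hslim h24i h24ii`
of (iii), outside the cone count) (v0.2: CONE 47 · FACT 0 · side 8; v0.1: 48 · 1 · 8); law (a) for the ∞κ-pair: binder → THEOREM.  Nodes 139 unchanged.  S-FREE (no [IUTchI] node consumes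
`Cor312.PilotKummerIndRelated`).  Post-freeze-additive / proof-only modules imported for the closers (not cone members):
GlobalFrobenioidsCoricRigidityGenuineKummer (p432037, over GlobalFrobenioidsCoricKummerNaturality p431351 / KummerNaturalityPartialAut
p431112), TemperedCoveringsCor23ReducedOfSpecialFibre (p431563/p431767/p431985), StableCurveTemperedDataOfSpecialFibreWholeGraph (p433082) — all
proof-only.

Mochizuki, *Inter-universal Teichmüller theory I: construction of Hodge theaters*, kurims manuscript (May 2020) [cite: Mochizuki2012]
(D-0012 claim key; series status DISPUTED).  HONEST FRAMING: nothing in this file asserts that abc is proved or refuted or takes a side on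
[IUTchIII] Cor. 3.12 (nor on [IUTchI]); every binder is an ASSUMPTION LABEL (a law instance at the genuine object, or an L1/L2/L3/L4 merge
atom), not an endorsement; every conjunct is a CLOSED statement obtained by applying a LANDED closer BY NAME; typed ≠ inhabited ≠
discharged; indexed ≠ endorsed; establishment = OUR kernel check only.  Every later version only REMOVES binders (law instance PROVED in
tree) or SPLITS one into strictly weaker named ones, or SPECIALISES a free datum parameter to print's value.
Second readers: abc-iut-L5-d5 g5, abc-iut-L5-t16 g5.
-/

namespace Summit.ABC.IUTFork.Conditional

open CategoryTheory Literature.IUT.HodgeTheaters ProfiniteGrp ProfiniteGrp.ProfiniteCompletion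
open Literature.AnabelianGeometry.EtaleTheta Literature.AnabelianGeometry.EtaleTheta.ZHatLevel

universe u v w'

/-! ## (i) Ex 5.1 (v): conjunct 1 at the genuine Kummer map — law (a) a theorem -/

/-- **Row 1116, node `IUTchI:Ex5.1(v)`, v0.3** (class (c)) ([IUTchI] Ex 5.1 (v) pp.127–129), CLOSED CONJUNCTS from LAW-INSTANCE
BINDERS — v0.2's `layer5_held_ex51v_v2` (p433973; v0.1 author of record abc-iut-w5-d110) with: conjunct 1 (∞κ, E51/L29) AT THE GENUINE KUMMER MAP via
abc-iut-w4-d056's `NFBridgeRecon.existsUniqueCoricStructure_infκPair_kummerMap` (p432037): Kummer realisation, container and both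
actions INTERNAL (L2 `kummerMap` / `H1Colimit`), law (a) a THEOREM there, laws (b′) `h_Ex51v_ord` / Rmk 3.1.7 (i)(ii) read on the
`π₁^rat`-FIXED ∞κ-coric functions — NO `MκIsInvariants` (F-2571) input and NO naturality binder; instead the Kummer injectivity
`h_Ex51v_inj` (E51/L26) and the structural side conditions `hcoe hprim hc h1 hpow`; the ∞κ pole law DERIVED from the ∞κ× one
`h_Ex51v_polex` and the ∞κ× two-zeroes witness DERIVED from the ∞κ one `h_Ex51v_zero` through `NFBridgeRecon.minfκ_subset`
(`𝕄^⊛_∞κ ⊆ 𝕄^⊛_∞κ×`, Ex 5.1 (i)); conjuncts 2–8 and their closers verbatim as v0.1 (p424116 `…_infκxPair_of_divisors`, p424820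
`UniqueCyclotomeIso.of_laws`, p427568 `UniqueCyclotomeIsoFamily.of_integral_laws`, p413972, p407751); NEW conjunct 9 = E51/L31
`CoricPair.DeterminesInfκStructure κx.toFun R N.infκPair` («any ∞κ×-coric structure determines an ∞κ-coric structure», read at the
model ∞κ×-pair with its Kummer realisation `κx`; text of the author of record abc-iut-w5-d110) from the Rmk 3.1.7 (ii) torsion
criterion `h_Ex51v_tors_some`/`h_Ex51v_tors_every` (closer p430736 `NFBridgeRecon.determinesInfκStructure_infκxPair_of_criterion`).
Data binders: the reconstruction output `N` (L4 [AbsTopIII] Thm 1.9 merge; universe 0), the genuine Kummer lane's units action /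
rootability / level system `S`, a Kummer container `H` with its `π₁^rat`- and `Ẑ^×`-actions and the realisations `κ`/`κx` of the
two model pairs (conjuncts 2, 7; L2 Kummer-map merge, GAP G-w4d056-2), an order map `ord` ([AbsTopIII] Prop 1.6 (iii)), the cyclotome
comparison data `C` (∞κ case) and `Cf` (`†𝕄^⊛` case with layers `⊛/sol/mod` and integral submonoids `𝒪^⊿_𝔭`), and for E51/L31 the
Kummer restriction data `R` on the container `H` (open subgroups of decomposition groups of strictly critical points).  Law binders (21): Kummer injectivity; (a) naturality (∞κ× only); (b′) divisor transport ×2; Rmk 3.1.7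
pole law (∞κ×, fixed) + two-zeroes witness (∞κ, fixed) + `h_Ex51v_moves`; (E)(T)(D)+Rmk 3.1.7 for `C` ×6; (E)(T)(V)(I)(P) for `Cf` ×6;
torsion criterion ×2.  Structural side conditions (5): `hcoe hprim hc h1 hpow`.  FACT binders: none.  Nothing here asserts that abc
is proved or refuted or takes a side on [IUTchIII] Cor. 3.12; a binder is an assumption label; typed ≠ discharged. -/
theorem layer5_held_ex51v_v3 (N : NFBridgeRecon.{0})
    -- DATA (GENUINE, L2 Kummer lane — universe 0): a units action of `π₁^rat` on `K_rat^×` compatible with the field action,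
    -- `K_rat^×` rootable, a non-empty directed system `S` of NORMAL subgroups of `π₁^rat` (the levels of `lim_{→ H} H¹(H, ·)`)
    [MulDistribMulAction N.piRat N.Kratˣ] [RootableBy N.Kratˣ ℕ]
    {ι : Type} [Preorder ι] [DecidableEq ι] [IsDirectedOrder ι] [Nonempty ι] (S : ι → Subgroup N.piRat)
    [∀ i, (S i).Normal] (hS : ∀ ⦃i j : ι⦄, i ≤ j → S j ≤ S i)
    -- STRUCTURAL SIDE CONDITIONS of the genuine Kummer map (abc-iut-w4-d056, p431351/p432037): compatibility of the units
    -- action, roots of unity of every order in `K_rat`, `S` exhausts `K_rat^×` by invariants, `1 ∈ 𝕄^⊛_∞κ` and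
    -- `f ∈ 𝕄^⊛_∞κ ⇔ fⁿ ∈ 𝕄^⊛_∞κ` (Rmk 3.1.7 (ii): the definition of ∞κ-coric)
    (hcoe : ∀ (g : N.piRat) (a : N.Kratˣ), ((g • a : N.Kratˣ) : N.Krat) = g • (a : N.Krat))
    (hprim : ∀ n : ℕ, 0 < n → ∃ ζ : N.Krat, IsPrimitiveRoot ζ n) (hc : IsExhausted N.Kratˣ S)
    (h1 : (1 : N.Krat) ∈ N.Minfκ) (hpow : ∀ (f : N.Krat) (n : ℕ), 0 < n → (f ∈ N.Minfκ ↔ f ^ n ∈ N.Minfκ))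
    -- LAW E51/L26 «the asserted injectivity» of the genuine Kummer map on `K_rat^×` (Kummer theory of the function fields)
    (h_Ex51v_inj : Function.Injective (kummerMap hS hc))
    -- DATA: a Kummer container and realisations of the two model pairs (conjuncts 2 and 7; L2 Kummer-map merge)
    (H : Type) [CommGroup H] [MulAction N.piRat H]
    [MulAction (MulAut (completion (GrpCat.of (Multiplicative ℤ)))) H]
    (κ : N.infκPair.KummerRealization H) (κx : N.infκxPair.KummerRealization H)
    -- LAW (a) Kummer naturality for the ∞κ×-pair ONLY (for the ∞κ-pair it is a THEOREM at the genuine Kummer map,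
    -- abc-iut-w4-d056 `infκPair_exists_zhatTwist_kummerMap_iso`, consumed inside the closer of conjunct 1)
    (h_Ex51v_natx : ∀ e : CoricPair.Iso N.infκxPair N.infκxPair,
      ∃ u : MulAut (completion (GrpCat.of (Multiplicative ℤ))),
        ∀ x : N.infκxPair.carrier, κx.toFun (e.toEquiv x) = u • κx.toFun x)
    -- DATA: orders at points ([AbsTopIII] Prop 1.6 (iii))
    {X : Type v} (ord : X → N.Krat → ℤ)
    -- LAW (b′) divisor transport, both pairs, on the `π₁^rat`-FIXED elements («Kummer classes of rational functions»);
    -- for the ∞κ-pair read at the GENUINE Kummer classes `kummerMap f ∈ lim_{→ i} H¹(S i, Λ(K_rat^×))`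
    (h_Ex51v_ord : ∀ (u : MulAut (completion (GrpCat.of (Multiplicative ℤ)))) (f f' : N.infκPair.carrier),
      (∀ g : N.piRat, g • (f : N.Krat) = f) → (∀ g : N.piRat, g • (f' : N.Krat) = f') →
      kummerMap hS hc (Units.mk0 (f' : N.Krat) (N.coe_infκPair_ne_zero f')) =
        H1ColimTwist S hS u (kummerMap hS hc (Units.mk0 (f : N.Krat) (N.coe_infκPair_ne_zero f))) →
      ∀ x : X, u (eta (ord x f)) = eta (ord x f'))
    (h_Ex51v_ordx : ∀ (u : MulAut (completion (GrpCat.of (Multiplicative ℤ)))) (f f' : N.infκxPair.carrier),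
      (∀ g : N.piRat, g • (f : N.Krat) = f) → (∀ g : N.piRat, g • (f' : N.Krat) = f') →
      κx.toFun f' = u • κx.toFun f → ∀ x : X, u (eta (ord x f)) = eta (ord x f'))
    -- LAW Rmk 3.1.7 (i)/(ii): pole shape of invariant ∞κ×-coric functions (⊇ the ∞κ-coric ones, `minfκ_subset`);
    -- a `π₁^rat`-fixed ∞κ-coric function with two distinct zeroes (hence also an ∞κ×-coric one)
    (h_Ex51v_polex : ∀ f' ∈ N.Minfκx, (∀ g : N.piRat, g • f' = f') →
      ∀ x₁ x₂ : X, x₁ ≠ x₂ → ¬ (ord x₁ f' < 0 ∧ ord x₂ f' < 0))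
    (h_Ex51v_zero : ∃ f ∈ N.Minfκ, (∀ g : N.piRat, g • f = f) ∧
      ∃ x₁ x₂ : X, x₁ ≠ x₂ ∧ 0 < ord x₁ f ∧ 0 < ord x₂ f)
    -- LAW Rmk 3.1.7 (ii)/(iii) for E51/L23: `π₁^{rat/κ-sol}` moves some ∞κ×-coric function (a constant)
    (h_Ex51v_moves : ∃ g ∈ N.ratKsolKer, ∃ f ∈ N.Minfκx, g • f ≠ f)
    -- DATA + LAWS for E51/L27 (∞κ cyclotome comparison): (E)(T)(D) + Rmk 3.1.7
    (C : CyclotomeComparison.{u})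
    (zμ : MulAut (completion (GrpCat.of (Multiplicative ℤ))) → (C.μ₁ ≃* C.μ₂) → (C.μ₁ ≃* C.μ₂))
    (h_Ex51v_zμ_one : ∀ e, zμ 1 e = e)
    (twist : MulAut (completion (GrpCat.of (Multiplicative ℤ))) → C.H₂ → C.H₂)
    (h_Ex51v_E : ∃ e₀ : C.μ₁ ≃* C.μ₂, Set.BijOn (C.induced e₀) C.im₁ C.im₂)
    (h_Ex51v_T : ∀ e e' : C.μ₁ ≃* C.μ₂, ∃ u : MulAut (completion (GrpCat.of (Multiplicative ℤ))),
      e' = zμ u e ∧ ∀ h, C.induced e' h = twist u (C.induced e h))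
    {Pt : Type v} (ordC : Pt → C.H₂ → ℤ)
    (h_Ex51v_D : ∀ u : MulAut (completion (GrpCat.of (Multiplicative ℤ))), Set.MapsTo (twist u) C.im₂ C.im₂ →
      ∀ h ∈ C.im₂, ∀ x : Pt, u (eta (ordC x h)) = eta (ordC x (twist u h)))
    (h_Ex51v_Ctwo : ∃ h ∈ C.im₂, ∃ x₁ x₂ : Pt, x₁ ≠ x₂ ∧ 0 < ordC x₁ h ∧ 0 < ordC x₂ h)
    (h_Ex51v_Cone : ∀ h ∈ C.im₂, ∀ x₁ x₂ : Pt, x₁ ≠ x₂ → ¬ (ordC x₁ h < 0 ∧ ordC x₂ h < 0))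
    -- DATA + LAWS for E51/L28 (`†𝕄^⊛` display, layers ⊛/sol/mod, integral submonoids): (E)(T)(V)(I)(P)
    {𝔓 : Type w'} (Cf : CyclotomeComparisonFamily AstLayer 𝔓)
    (zμf : MulAut (completion (GrpCat.of (Multiplicative ℤ))) → (Cf.μ₁ ≃* Cf.μ₂) → (Cf.μ₁ ≃* Cf.μ₂))
    (h_Ex51v_zμf_one : ∀ e, zμf 1 e = e)
    (twistf : MulAut (completion (GrpCat.of (Multiplicative ℤ))) → Cf.H₂ → Cf.H₂)
    (h_Ex51v_fE : ∃ e, Cf.InducesCompatibleIsos e)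
    (h_Ex51v_fT : ∀ e e' : Cf.μ₁ ≃* Cf.μ₂, ∃ u : MulAut (completion (GrpCat.of (Multiplicative ℤ))),
      e' = zμf u e ∧ ∀ h, Cf.induced e' h = twistf u (Cf.induced e h))
    (val : 𝔓 → Cf.H₂ → ℤ)
    (h_Ex51v_fV : ∀ u : MulAut (completion (GrpCat.of (Multiplicative ℤ))),
      Set.MapsTo (twistf u) (Cf.im₂ AstLayer.mod) (Cf.im₂ AstLayer.mod) →
        ∀ h ∈ Cf.im₂ AstLayer.mod, ∀ 𝔭 : 𝔓, u (eta (val 𝔭 h)) = eta (val 𝔭 (twistf u h)))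
    (h_Ex51v_fI : ∀ 𝔭 : 𝔓, ∀ h ∈ Cf.im₂ AstLayer.mod, h ∈ Cf.int₂ 𝔭 → 0 ≤ val 𝔭 h)
    (h_Ex51v_fP : ∃ 𝔭₀ : 𝔓, ∃ h ∈ Cf.im₂ AstLayer.mod, h ∈ Cf.int₂ 𝔭₀ ∧ 0 < val 𝔭₀ h)
    -- DATA + LAW for E51/L31 (p.129 l.5–24; text of the author of record abc-iut-w5-d110, 4e919baf55567098): Kummer restriction
    -- data at [open subgroups of decomposition groups of] strictly critical points + the Rmk 3.1.7 (ii) torsion criterion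
    -- («some [or, equivalently, every]») for the Kummer classes of the ∞κ×-coric functions
    (R : CriticalRestrictionData N.piRat H)
    (h_Ex51v_tors_some : ∀ f : N.infκxPair.carrier,
      (f : N.Krat) ∈ N.Minfκ ↔ ∃ i : R.Idx, IsOfFinOrder (R.res i (κx.toFun f)))
    (h_Ex51v_tors_every : ∀ f : N.infκxPair.carrier,
      (f : N.Krat) ∈ N.Minfκ ↔ ∀ i : R.Idx, IsOfFinOrder (R.res i (κx.toFun f))) :
    -- CLOSED CONJUNCTS of node IUTchI:Ex5.1(v)
    ExistsUniqueCoricStructure N.piRat N.infκPair ∧                       -- E51/L29 (∞κ)  [GENUINE Kummer map: p432037]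
    ExistsUniqueCoricStructure N.piRat N.infκxPair ∧                      -- E51/L29 (∞κ×)
    UniqueCyclotomeIso C ∧                                                -- E51/L27
    UniqueCyclotomeIsoFamily Cf ∧                                         -- E51/L28
    (∀ P' : CoricPair N.piRat, IsCoricStructure N.piRat N.infκPair P' →   -- E51/L22
      P'.FactorsThrough N.ratKsolKer) ∧
    (∀ P' : CoricPair N.piRat, IsCoricStructure N.piRat N.infκxPair P' →  -- E51/L23
      ¬ P'.FactorsThrough N.ratKsolKer) ∧
    (∀ P' P'' : CoricPair N.piRat, ∀ (h : IsCoricStructure N.piRat N.infκPair P') -- E51/L26+L29, 2 structures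
      (h' : IsCoricStructure N.piRat N.infκPair P''),
      ∃! e : CoricPair.Iso P' P'',
        e.IsCompatible (CoricPair.KummerRealization.ofIso h.nonempty_iso.some κ)
          (CoricPair.KummerRealization.ofIso h'.nonempty_iso.some κ)) ∧
    N.minfκUnits ⊆ N.minfκxUnits ∧                                        -- E51/L30 (unconditional)
    CoricPair.DeterminesInfκStructure κx.toFun R N.infκPair :=            -- E51/L31 (as v0.2)
  ⟨N.existsUniqueCoricStructure_infκPair_kummerMap S hS hcoe hprim hc h1 hpow h_Ex51v_inj ord h_Ex51v_ord
      (fun f' hf' hfix => h_Ex51v_polex f' (N.minfκ_subset hf') hfix) h_Ex51v_zero,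
    N.existsUniqueCoricStructure_infκxPair_of_divisors κx h_Ex51v_natx ord h_Ex51v_ordx h_Ex51v_polex
      (h_Ex51v_zero.imp fun _ hf => ⟨N.minfκ_subset hf.1, hf.2⟩),
    UniqueCyclotomeIso.of_laws C zμ h_Ex51v_zμ_one twist h_Ex51v_E h_Ex51v_T ordC h_Ex51v_D h_Ex51v_Ctwo
      h_Ex51v_Cone,
    UniqueCyclotomeIsoFamily.of_integral_laws Cf AstLayer.mod zμf h_Ex51v_zμf_one twistf h_Ex51v_fE h_Ex51v_fT
      val h_Ex51v_fV h_Ex51v_fI h_Ex51v_fP,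
    fun _ h => NFBridgeRecon.IsCoricStructure.factorsThrough_ratKsolKer N h,
    fun _ h => NFBridgeRecon.IsCoricStructure.not_factorsThrough_ratKsolKer N h h_Ex51v_moves,
    fun _ _ h h' => IsCoricStructure.existsUnique_iso κ h h',
    N.minfκUnits_subset,
    N.determinesInfκStructure_infκxPair_of_criterion κx.toFun R h_Ex51v_tors_some h_Ex51v_tors_every⟩

/-! ## (ii) §2 held rows at print's parameter `Π̂_ℍ := closure(Π^tp_ℍ)` -/

section Sec2V3

open scoped Pointwise
open Topology Literature.AnabelianGeometry.SemiGraphs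

/-- **v0.3: [IUTchI] §2 held rows at the GENUINE 𝔛-datum with PRINT'S parameter `Π̂_ℍ := closure(Π^tp_ℍ)`** (abc-iut-w4-d058 (B)) — the
conjuncts Cor 2.3 (i)–(vi), Cor 2.5 (decomposition + inertia), Prop 2.4 (iii) of v0.2's `layer5_held_sec2_v2` at the datum
`StableCurveTemperedData.ofSpecialFibre X d S h36 Sigma SigmaHat hsub hne hprime hp TpH (closure (Π^tp_ℍ ↪ Π̂_𝔾)) (le_topologicalClosure) cuspMeetsH`
— print's `Π̂_ℋ` (p.44 l.39–44) IS that closure — so `hH` («`Π̂_ℍ` = closure of `Π^tp_ℍ`») holds by `rfl` and the data `HatH`/`hle` are gone;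
`hker` is discharged inside the closer (p431082).  Law binders: h22 · hOutTp · hA' · hB' · hv · htp · hhat · h24i · h24ii = 9.  DATA binders:
the datum's parameters (`X d S h36 Sigma SigmaHat hsub hne hprime hp TpH cuspMeetsH`) and a cusp `x`.  Closers BY NAME:
`cor23_i_to_iv_ofSpecialFibre_reduced_closureH` (abc-iut-w4-d058 p431767, over abc-iut-L5-d5's reduced route), `cor23v_of_graph` (abc-iut-L5-d4),
`cor23vi_of_graph` (abc-iut-L5-d5), `cor25_ofSpecialFibre`, `prop24iii_ofSpecialFibre` (abc-iut-L5-t11).  The `HatH` argument is spelled with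
the RAW completion map `….choose_spec.choose.toMonoidHom` (not `iotaG`) so that the `Subgroup.le_topologicalClosure _` proofs unify
syntactically (abc-iut-w4-d058's NB).  Nothing here asserts that abc is proved or refuted or takes a side on [IUTchIII] Cor. 3.12; a binder
is an assumption label; typed ≠ discharged. -/
theorem layer5_held_sec2_v3_closureH
    {p : ℕ} [Fact p.Prime] (X : Literature.AnabelianGeometry.SemiGraphs.TemperedCurve p) (d : X.GroupLevelData)
    (S : Literature.AnabelianGeometry.SemiGraphs.SpecialFibreData (X.toTemperedArithmeticGroup d)) (h36 : S.Gc.Prop36Hypotheses)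
    (Sigma SigmaHat : Set ℕ) (hsub : Sigma ⊆ SigmaHat) (hne : Sigma.Nonempty)
    (hprime : ∀ q ∈ SigmaHat, q.Prime) (hp : p ∉ Sigma) (TpH : Subgroup S.chart.G)
    (cuspMeetsH : {x : X.Pt // X.IsCusp x} → Prop) (x : {x : X.Pt // X.IsCusp x})
    (h22 : (StableCurveTemperedData.ofSpecialFibre X d S h36 Sigma SigmaHat hsub hne hprime hp TpH ((TpH.map (TemperedGraphGroupData.exists_completion_of_prop36 S.Gc h36 S.chart).choose_spec.choose.toMonoidHom).topologicalClosure) (Subgroup.le_topologicalClosure _)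
      cuspMeetsH).graph.CommensuratorsOfDecompositionSubgroups)
    (hOutTp : ∀ g : (StableCurveTemperedData.ofSpecialFibre X d S h36 Sigma SigmaHat hsub hne hprime hp TpH ((TpH.map (TemperedGraphGroupData.exists_completion_of_prop36 S.Gc h36 S.chart).choose_spec.choose.toMonoidHom).topologicalClosure) (Subgroup.le_topologicalClosure _) cuspMeetsH).PiTp,
      ∃ δ : (StableCurveTemperedData.ofSpecialFibre X d S h36 Sigma SigmaHat hsub hne hprime hp TpH ((TpH.map (TemperedGraphGroupData.exists_completion_of_prop36 S.Gc h36 S.chart).choose_spec.choose.toMonoidHom).topologicalClosure) (Subgroup.le_topologicalClosure _) cuspMeetsH).DeltaTp,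
        MulAut.conj g • ((StableCurveTemperedData.ofSpecialFibre X d S h36 Sigma SigmaHat hsub hne hprime hp TpH ((TpH.map (TemperedGraphGroupData.exists_completion_of_prop36 S.Gc h36 S.chart).choose_spec.choose.toMonoidHom).topologicalClosure) (Subgroup.le_topologicalClosure _)
            cuspMeetsH).deltaTpH.map
          (StableCurveTemperedData.ofSpecialFibre X d S h36 Sigma SigmaHat hsub hne hprime hp TpH ((TpH.map (TemperedGraphGroupData.exists_completion_of_prop36 S.Gc h36 S.chart).choose_spec.choose.toMonoidHom).topologicalClosure) (Subgroup.le_topologicalClosure _) cuspMeetsH).DeltaTp.subtype) =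
        MulAut.conj (δ : (StableCurveTemperedData.ofSpecialFibre X d S h36 Sigma SigmaHat hsub hne hprime hp TpH ((TpH.map (TemperedGraphGroupData.exists_completion_of_prop36 S.Gc h36 S.chart).choose_spec.choose.toMonoidHom).topologicalClosure) (Subgroup.le_topologicalClosure _)
            cuspMeetsH).PiTp) •
          ((StableCurveTemperedData.ofSpecialFibre X d S h36 Sigma SigmaHat hsub hne hprime hp TpH ((TpH.map (TemperedGraphGroupData.exists_completion_of_prop36 S.Gc h36 S.chart).choose_spec.choose.toMonoidHom).topologicalClosure) (Subgroup.le_topologicalClosure _) cuspMeetsH).deltaTpH.map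
            (StableCurveTemperedData.ofSpecialFibre X d S h36 Sigma SigmaHat hsub hne hprime hp TpH ((TpH.map (TemperedGraphGroupData.exists_completion_of_prop36 S.Gc h36 S.chart).choose_spec.choose.toMonoidHom).topologicalClosure) (Subgroup.le_topologicalClosure _) cuspMeetsH).DeltaTp.subtype))
    (hA' : (∃ l ∈ SigmaHat, l ∉ Sigma ∧ l ≠ p) →
      ∀ W : Subgroup (StableCurveTemperedData.ofSpecialFibre X d S h36 Sigma SigmaHat hsub hne hprime hp TpH ((TpH.map (TemperedGraphGroupData.exists_completion_of_prop36 S.Gc h36 S.chart).choose_spec.choose.toMonoidHom).topologicalClosure) (Subgroup.le_topologicalClosure _) cuspMeetsH).DeltaHat,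
        W.Normal → IsOpen (W : Set (StableCurveTemperedData.ofSpecialFibre X d S h36 Sigma SigmaHat hsub hne hprime hp TpH ((TpH.map (TemperedGraphGroupData.exists_completion_of_prop36 S.Gc h36 S.chart).choose_spec.choose.toMonoidHom).topologicalClosure) (Subgroup.le_topologicalClosure _)
          cuspMeetsH).DeltaHat) →
        ∀ a : (StableCurveTemperedData.ofSpecialFibre X d S h36 Sigma SigmaHat hsub hne hprime hp TpH ((TpH.map (TemperedGraphGroupData.exists_completion_of_prop36 S.Gc h36 S.chart).choose_spec.choose.toMonoidHom).topologicalClosure) (Subgroup.le_topologicalClosure _) cuspMeetsH).DeltaHat,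
          (∀ x ∈ W, x ∈ (StableCurveTemperedData.ofSpecialFibre X d S h36 Sigma SigmaHat hsub hne hprime hp TpH ((TpH.map (TemperedGraphGroupData.exists_completion_of_prop36 S.Gc h36 S.chart).choose_spec.choose.toMonoidHom).topologicalClosure) (Subgroup.le_topologicalClosure _)
            cuspMeetsH).ρHat.ker → a * x = x * a) → a ∈ W)
    (hB' : SigmaHat = {q | q.Prime} →
      ∀ W : Subgroup (StableCurveTemperedData.ofSpecialFibre X d S h36 Sigma SigmaHat hsub hne hprime hp TpH ((TpH.map (TemperedGraphGroupData.exists_completion_of_prop36 S.Gc h36 S.chart).choose_spec.choose.toMonoidHom).topologicalClosure) (Subgroup.le_topologicalClosure _) cuspMeetsH).DeltaHat,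
        W.Normal → IsOpen (W : Set (StableCurveTemperedData.ofSpecialFibre X d S h36 Sigma SigmaHat hsub hne hprime hp TpH ((TpH.map (TemperedGraphGroupData.exists_completion_of_prop36 S.Gc h36 S.chart).choose_spec.choose.toMonoidHom).topologicalClosure) (Subgroup.le_topologicalClosure _)
          cuspMeetsH).DeltaHat) →
        ∀ a : (StableCurveTemperedData.ofSpecialFibre X d S h36 Sigma SigmaHat hsub hne hprime hp TpH ((TpH.map (TemperedGraphGroupData.exists_completion_of_prop36 S.Gc h36 S.chart).choose_spec.choose.toMonoidHom).topologicalClosure) (Subgroup.le_topologicalClosure _) cuspMeetsH).DeltaHat,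
          (∀ x ∈ W, x ∈ (StableCurveTemperedData.ofSpecialFibre X d S h36 Sigma SigmaHat hsub hne hprime hp TpH ((TpH.map (TemperedGraphGroupData.exists_completion_of_prop36 S.Gc h36 S.chart).choose_spec.choose.toMonoidHom).topologicalClosure) (Subgroup.le_topologicalClosure _)
            cuspMeetsH).ρHat.ker → a * x = x * a) → a ∈ W)
    (hv : ((StableCurveTemperedData.ofSpecialFibre X d S h36 Sigma SigmaHat hsub hne hprime hp TpH ((TpH.map (TemperedGraphGroupData.exists_completion_of_prop36 S.Gc h36 S.chart).choose_spec.choose.toMonoidHom).topologicalClosure) (Subgroup.le_topologicalClosure _) cuspMeetsH).graph.HatH : Set (StableCurveTemperedData.ofSpecialFibre X d S h36 Sigma SigmaHat hsub hne hprime hp TpH ((TpH.map (TemperedGraphGroupData.exists_completion_of_prop36 S.Gc h36 S.chart).choose_spec.choose.toMonoidHom).topologicalClosure) (Subgroup.le_topologicalClosure _) cuspMeetsH).graph.Hat) ∩ Set.range (StableCurveTemperedData.ofSpecialFibre X d S h36 Sigma SigmaHat hsub hne hprime hp TpH ((TpH.map (TemperedGraphGroupData.exists_completion_of_prop36 S.Gc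 h36 S.chart).choose_spec.choose.toMonoidHom).topologicalClosure) (Subgroup.le_topologicalClosure _) cuspMeetsH).graph.ι =
      (StableCurveTemperedData.ofSpecialFibre X d S h36 Sigma SigmaHat hsub hne hprime hp TpH ((TpH.map (TemperedGraphGroupData.exists_completion_of_prop36 S.Gc h36 S.chart).choose_spec.choose.toMonoidHom).topologicalClosure) (Subgroup.le_topologicalClosure _) cuspMeetsH).graph.ι '' (StableCurveTemperedData.ofSpecialFibre X d S h36 Sigma SigmaHat hsub hne hprime hp TpH ((TpH.map (TemperedGraphGroupData.exists_completion_of_prop36 S.Gc h36 S.chart).choose_spec.choose.toMonoidHom).topologicalClosure) (Subgroup.le_topologicalClosure _) cuspMeetsH).graph.TpH)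
    (htp : ∀ x : (StableCurveTemperedData.ofSpecialFibre X d S h36 Sigma SigmaHat hsub hne hprime hp TpH ((TpH.map (TemperedGraphGroupData.exists_completion_of_prop36 S.Gc h36 S.chart).choose_spec.choose.toMonoidHom).topologicalClosure) (Subgroup.le_topologicalClosure _) cuspMeetsH).Cusp, (StableCurveTemperedData.ofSpecialFibre X d S h36 Sigma SigmaHat hsub hne hprime hp TpH ((TpH.map (TemperedGraphGroupData.exists_completion_of_prop36 S.Gc h36 S.chart).choose_spec.choose.toMonoidHom).topologicalClosure) (Subgroup.le_topologicalClosure _) cuspMeetsH).cuspMeetsH x →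
      ∃ t : (StableCurveTemperedData.ofSpecialFibre X d S h36 Sigma SigmaHat hsub hne hprime hp TpH ((TpH.map (TemperedGraphGroupData.exists_completion_of_prop36 S.Gc h36 S.chart).choose_spec.choose.toMonoidHom).topologicalClosure) (Subgroup.le_topologicalClosure _) cuspMeetsH).graph.Tp, ((StableCurveTemperedData.ofSpecialFibre X d S h36 Sigma SigmaHat hsub hne hprime hp TpH ((TpH.map (TemperedGraphGroupData.exists_completion_of_prop36 S.Gc h36 S.chart).choose_spec.choose.toMonoidHom).topologicalClosure) (Subgroup.le_topologicalClosure _) cuspMeetsH).inertiaTp x).map (StableCurveTemperedData.ofSpecialFibre X d S h36 Sigma SigmaHat hsub hne hprime hp TpH ((TpH.map (TemperedGraphGroupData.exists_completion_of_prop36 S.Gc h36 S.chart).choose_spec.choose.toMonoidHom).topologicalClosure) (Subgroup.le_topologicalClosure _) cuspMeetsH).ρTp ≤ MulAut.conj t • (StableCurveTemperedData.ofSpecialFibre X d S h36 Sigma SigmaHat hsub hne hprime hp TpH ((TpH.map (TemperedGraphGroupData.exists_completion_of_prop36 S.Gc h36 S.chart).choose_spec.choose.toMonoidHom).topologicalClosure)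 (Subgroup.le_topologicalClosure _) cuspMeetsH).graph.TpH)
    (hhat : ∀ x : (StableCurveTemperedData.ofSpecialFibre X d S h36 Sigma SigmaHat hsub hne hprime hp TpH ((TpH.map (TemperedGraphGroupData.exists_completion_of_prop36 S.Gc h36 S.chart).choose_spec.choose.toMonoidHom).topologicalClosure) (Subgroup.le_topologicalClosure _) cuspMeetsH).Cusp,
      (∃ g : (StableCurveTemperedData.ofSpecialFibre X d S h36 Sigma SigmaHat hsub hne hprime hp TpH ((TpH.map (TemperedGraphGroupData.exists_completion_of_prop36 S.Gc h36 S.chart).choose_spec.choose.toMonoidHom).topologicalClosure) (Subgroup.le_topologicalClosure _) cuspMeetsH).graph.Hat, (((StableCurveTemperedData.ofSpecialFibre X d S h36 Sigma SigmaHat hsub hne hprime hp TpH ((TpH.map (TemperedGraphGroupData.exists_completion_of_prop36 S.Gc h36 S.chart).choose_spec.choose.toMonoidHom).topologicalClosure) (Subgroup.le_topologicalClosure _) cuspMeetsH).inertiaTp x).map (StableCurveTemperedData.ofSpecialFibre X d S h36 Sigma SigmaHat hsub hne hprime hp TpH ((TpH.map (TemperedGraphGroupData.exists_completion_of_prop36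 S.Gc h36 S.chart).choose_spec.choose.toMonoidHom).topologicalClosure) (Subgroup.le_topologicalClosure _) cuspMeetsH).ρTp).map (StableCurveTemperedData.ofSpecialFibre X d S h36 Sigma SigmaHat hsub hne hprime hp TpH ((TpH.map (TemperedGraphGroupData.exists_completion_of_prop36 S.Gc h36 S.chart).choose_spec.choose.toMonoidHom).topologicalClosure) (Subgroup.le_topologicalClosure _) cuspMeetsH).graph.ι ≤
        MulAut.conj g • (StableCurveTemperedData.ofSpecialFibre X d S h36 Sigma SigmaHat hsub hne hprime hp TpH ((TpH.map (TemperedGraphGroupData.exists_completion_of_prop36 S.Gc h36 S.chart).choose_spec.choose.toMonoidHom).topologicalClosure) (Subgroup.le_topologicalClosure _) cuspMeetsH).graph.HatH) → (StableCurveTemperedData.ofSpecialFibre X d S h36 Sigma SigmaHat hsub hne hprime hp TpH ((TpH.map (TemperedGraphGroupData.exists_completion_of_prop36 S.Gc h36 S.chart).choose_spec.choose.toMonoidHom).topologicalClosure) (Subgroup.le_topologicalClosure _) cuspMeetsH).cuspMeetsH x)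
    (h24i : (StableCurveTemperedData.ofSpecialFibre X d S h36 Sigma SigmaHat hsub hne hprime hp TpH ((TpH.map (TemperedGraphGroupData.exists_completion_of_prop36 S.Gc h36 S.chart).choose_spec.choose.toMonoidHom).topologicalClosure) (Subgroup.le_topologicalClosure _) cuspMeetsH).Prop24i)
    (h24ii : (StableCurveTemperedData.ofSpecialFibre X d S h36 Sigma SigmaHat hsub hne hprime hp TpH ((TpH.map (TemperedGraphGroupData.exists_completion_of_prop36 S.Gc h36 S.chart).choose_spec.choose.toMonoidHom).topologicalClosure) (Subgroup.le_topologicalClosure _) cuspMeetsH).Prop24ii) :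
    (StableCurveTemperedData.ofSpecialFibre X d S h36 Sigma SigmaHat hsub hne hprime hp TpH ((TpH.map (TemperedGraphGroupData.exists_completion_of_prop36 S.Gc h36 S.chart).choose_spec.choose.toMonoidHom).topologicalClosure) (Subgroup.le_topologicalClosure _) cuspMeetsH).Cor23i ∧ (StableCurveTemperedData.ofSpecialFibre X d S h36 Sigma SigmaHat hsub hne hprime hp TpH ((TpH.map (TemperedGraphGroupData.exists_completion_of_prop36 S.Gc h36 S.chart).choose_spec.choose.toMonoidHom).topologicalClosure) (Subgroup.le_topologicalClosure _) cuspMeetsH).Cor23ii ∧ (StableCurveTemperedData.ofSpecialFibre X d S h36 Sigma SigmaHat hsub hne hprime hp TpH ((TpH.map (TemperedGraphGroupData.exists_completion_of_prop36 S.Gc h36 S.chart).choose_spec.choose.toMonoidHom).topologicalClosure) (Subgroup.le_topologicalClosure _) cuspMeetsH).Cor23iii ∧ (StableCurveTemperedData.ofSpecialFibre X d S h36 Sigma SigmaHat hsub hne hprime hp TpH ((TpH.map (TemperedGraphGroupData.exists_completion_of_prop36 S.Gc h36 S.chart).choose_spec.choose.toMonoidHom).topologicalClosure) (Subgroup.le_topologicalClosure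 _) cuspMeetsH).Cor23iv ∧ (StableCurveTemperedData.ofSpecialFibre X d S h36 Sigma SigmaHat hsub hne hprime hp TpH ((TpH.map (TemperedGraphGroupData.exists_completion_of_prop36 S.Gc h36 S.chart).choose_spec.choose.toMonoidHom).topologicalClosure) (Subgroup.le_topologicalClosure _) cuspMeetsH).Cor23v ∧ (StableCurveTemperedData.ofSpecialFibre X d S h36 Sigma SigmaHat hsub hne hprime hp TpH ((TpH.map (TemperedGraphGroupData.exists_completion_of_prop36 S.Gc h36 S.chart).choose_spec.choose.toMonoidHom).topologicalClosure) (Subgroup.le_topologicalClosure _) cuspMeetsH).Cor23vi ∧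
    ((StableCurveTemperedData.ofSpecialFibre X d S h36 Sigma SigmaHat hsub hne hprime hp TpH ((TpH.map (TemperedGraphGroupData.exists_completion_of_prop36 S.Gc h36 S.chart).choose_spec.choose.toMonoidHom).topologicalClosure) (Subgroup.le_topologicalClosure _) cuspMeetsH).Cor25Decomposition ∧ (StableCurveTemperedData.ofSpecialFibre X d S h36 Sigma SigmaHat hsub hne hprime hp TpH ((TpH.map (TemperedGraphGroupData.exists_completion_of_prop36 S.Gc h36 S.chart).choose_spec.choose.toMonoidHom).topologicalClosure) (Subgroup.le_topologicalClosure _) cuspMeetsH).Cor25Inertia) ∧ (StableCurveTemperedData.ofSpecialFibre X d S h36 Sigma SigmaHat hsub hne hprime hp TpH ((TpH.map (TemperedGraphGroupData.exists_completion_of_prop36 S.Gc h36 S.chart).choose_spec.choose.toMonoidHom).topologicalClosure) (Subgroup.le_topologicalClosure _) cuspMeetsH).Prop24iii :=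
  haveI : Nonempty X.Pt := ⟨x.1⟩
  haveI : Nonempty {x : X.Pt // X.IsCusp x} := ⟨x⟩
  have h14 := StableCurveTemperedData.cor23_i_to_iv_ofSpecialFibre_reduced_closureH X d S h36 Sigma SigmaHat hsub hne
    hprime hp TpH cuspMeetsH h22 hOutTp hA' hB'  -- `hH` definitional, `hker` discharged (abc-iut-w4-d058, p431767)
  ⟨h14.1, h14.2.1, h14.2.2.1, h14.2.2.2, (StableCurveTemperedData.ofSpecialFibre X d S h36 Sigma SigmaHat hsub hne hprime hp TpH ((TpH.map (TemperedGraphGroupData.exists_completion_of_prop36 S.Gc h36 S.chart).choose_spec.choose.toMonoidHom).topologicalClosure) (Subgroup.le_topologicalClosure _) cuspMeetsH).cor23v_of_graph hv,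
    (StableCurveTemperedData.ofSpecialFibre X d S h36 Sigma SigmaHat hsub hne hprime hp TpH ((TpH.map (TemperedGraphGroupData.exists_completion_of_prop36 S.Gc h36 S.chart).choose_spec.choose.toMonoidHom).topologicalClosure) (Subgroup.le_topologicalClosure _) cuspMeetsH).cor23vi_of_graph htp hhat,
    StableCurveTemperedData.cor25_ofSpecialFibre X d S h36 Sigma SigmaHat hsub hne hprime hp TpH ((TpH.map (TemperedGraphGroupData.exists_completion_of_prop36 S.Gc h36 S.chart).choose_spec.choose.toMonoidHom).topologicalClosure) (Subgroup.le_topologicalClosure _) cuspMeetsH h24i h24ii,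
    StableCurveTemperedData.prop24iii_ofSpecialFibre X d S h36 Sigma SigmaHat hsub hne hprime hp TpH ((TpH.map (TemperedGraphGroupData.exists_completion_of_prop36 S.Gc h36 S.chart).choose_spec.choose.toMonoidHom).topologicalClosure) (Subgroup.le_topologicalClosure _) cuspMeetsH x h24i⟩


end Sec2V3

/-! ## (iii) NON-VACUITY conjunct: the §2 binder set is jointly realisable at the genuine datum with `ℍ := 𝔾` -/

section Sec2WholeGraph

open scoped Pointwise
open Topology Literature.AnabelianGeometry.SemiGraphs
open Literature.AlgebraicGeometry.Frobenioids (IsSlimGroup)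

/-- **v0.3 NON-VACUITY conjunct (abc-iut-L5-lead gen 5 RULINGS #44 (2)(iii)): «the §2 binder set is JOINTLY REALISABLE at the genuine
datum, `ℍ = 𝔾`, modulo 3 named binders» — NOT a discharge of the general-`ℍ` node statements.**  In the instance `ℍ := 𝔾` of the
genuine 𝔛-datum (`Π^tp_ℍ := ⊤`, `Π̂_ℍ := ⊤`, `cuspMeetsH := fun _ => True`; print allows the sub-semi-graph `ℍ` to be all of `𝔾`,
[IUTchI] §2 p.44) every PARAMETER binder of the general block — `hH` (density), `hker`, `hOutTp`/`hOutHat` (outer descent), `hv`,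
`htp`, `hhat` — is a THEOREM (abc-iut-w4-d055, `StableCurveTemperedDataOfSpecialFibreWholeGraph.lean` p433082: `wholeGraph_hatH_eq_closure`,
`outerTp_of_graph_top`, `outerHat_of_graph_top`, `graph_hatH_inter_range_of_graph_top`, `inertia_map_le_conj_of_graph_top`, …), and the
WHOLE §2 conjunct list (Cor 2.3 (i)–(vi), Cor 2.5 decomposition + inertia, Prop 2.4 (iii)) holds there from THREE binders: `hslim`
(«`Δ̂_X` slim» given the Cor 2.3 hypotheses — [AbsTopII]/[SemiAnbd] slimness, the (iii) input), `h24i`, `h24ii` (Prop 2.4 (i)/(ii) at that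
datum).  Closer BY NAME: abc-iut-w4-d055's `StableCurveTemperedData.whole_graph_sec2_of_slim`.  DATA binders: the datum's parameters and
a cusp `x`.  This conjunct is CONSISTENCY EVIDENCE for the binder set of `layer5_held_sec2*` (it is not vacuous at the genuine object);
it is counted separately (NV 3), not in the CONE census.  Nothing here asserts that abc is proved or refuted or takes a side on
[IUTchIII] Cor. 3.12; instantiated ≠ endorsed; typed ≠ discharged. -/
theorem layer5_nv_sec2_wholeGraph
    {p : ℕ} [Fact p.Prime] (X : Literature.AnabelianGeometry.SemiGraphs.TemperedCurve p) (d : X.GroupLevelData)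
    (S : Literature.AnabelianGeometry.SemiGraphs.SpecialFibreData (X.toTemperedArithmeticGroup d)) (h36 : S.Gc.Prop36Hypotheses)
    (Sigma SigmaHat : Set ℕ) (hsub : Sigma ⊆ SigmaHat) (hne : Sigma.Nonempty)
    (hprime : ∀ q ∈ SigmaHat, q.Prime) (hp : p ∉ Sigma) (x : {x : X.Pt // X.IsCusp x})
    (hslim : (StableCurveTemperedData.ofSpecialFibre X d S h36 Sigma SigmaHat hsub hne hprime hp ⊤ ⊤
        (StableCurveTemperedData.wholeGraph_hle X d S h36) (fun _ => True)).Cor23Hyp →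
      IsSlimGroup (StableCurveTemperedData.ofSpecialFibre X d S h36 Sigma SigmaHat hsub hne hprime hp ⊤ ⊤
        (StableCurveTemperedData.wholeGraph_hle X d S h36) (fun _ => True)).deltaHatH)
    (h24i : (StableCurveTemperedData.ofSpecialFibre X d S h36 Sigma SigmaHat hsub hne hprime hp ⊤ ⊤
        (StableCurveTemperedData.wholeGraph_hle X d S h36) (fun _ => True)).Prop24i)
    (h24ii : (StableCurveTemperedData.ofSpecialFibre X d S h36 Sigma SigmaHat hsub hne hprime hp ⊤ ⊤
        (StableCurveTemperedData.wholeGraph_hle X d S h36) (fun _ => True)).Prop24ii) :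
    (StableCurveTemperedData.ofSpecialFibre X d S h36 Sigma SigmaHat hsub hne hprime hp ⊤ ⊤
        (StableCurveTemperedData.wholeGraph_hle X d S h36) (fun _ => True)).Cor23i ∧  -- IUTchI:Cor2.3(i) at ℍ = 𝔾
    (StableCurveTemperedData.ofSpecialFibre X d S h36 Sigma SigmaHat hsub hne hprime hp ⊤ ⊤
        (StableCurveTemperedData.wholeGraph_hle X d S h36) (fun _ => True)).Cor23ii ∧  -- IUTchI:Cor2.3(ii) at ℍ = 𝔾
    (StableCurveTemperedData.ofSpecialFibre X d S h36 Sigma SigmaHat hsub hne hprime hp ⊤ ⊤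
        (StableCurveTemperedData.wholeGraph_hle X d S h36) (fun _ => True)).Cor23iii ∧  -- IUTchI:Cor2.3(iii) at ℍ = 𝔾
    (StableCurveTemperedData.ofSpecialFibre X d S h36 Sigma SigmaHat hsub hne hprime hp ⊤ ⊤
        (StableCurveTemperedData.wholeGraph_hle X d S h36) (fun _ => True)).Cor23iv ∧  -- IUTchI:Cor2.3(iv) at ℍ = 𝔾
    (StableCurveTemperedData.ofSpecialFibre X d S h36 Sigma SigmaHat hsub hne hprime hp ⊤ ⊤
        (StableCurveTemperedData.wholeGraph_hle X d S h36) (fun _ => True)).Cor23v ∧  -- IUTchI:Cor2.3(v) at ℍ = 𝔾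
    (StableCurveTemperedData.ofSpecialFibre X d S h36 Sigma SigmaHat hsub hne hprime hp ⊤ ⊤
        (StableCurveTemperedData.wholeGraph_hle X d S h36) (fun _ => True)).Cor23vi ∧  -- IUTchI:Cor2.3(vi) at ℍ = 𝔾
    ((StableCurveTemperedData.ofSpecialFibre X d S h36 Sigma SigmaHat hsub hne hprime hp ⊤ ⊤
        (StableCurveTemperedData.wholeGraph_hle X d S h36) (fun _ => True)).Cor25Decomposition ∧
      (StableCurveTemperedData.ofSpecialFibre X d S h36 Sigma SigmaHat hsub hne hprime hp ⊤ ⊤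
        (StableCurveTemperedData.wholeGraph_hle X d S h36) (fun _ => True)).Cor25Inertia) ∧  -- IUTchI:Cor2.5 at ℍ = 𝔾
    (StableCurveTemperedData.ofSpecialFibre X d S h36 Sigma SigmaHat hsub hne hprime hp ⊤ ⊤
        (StableCurveTemperedData.wholeGraph_hle X d S h36) (fun _ => True)).Prop24iii :=  -- IUTchI:Prop2.4(iii) at ℍ = 𝔾
  StableCurveTemperedData.whole_graph_sec2_of_slim X d S h36 Sigma SigmaHat hsub hne hprime hp x hslim h24i h24ii

end Sec2WholeGraph

/-! ## The single top of record v3 -/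

/-- **THE LAYER-5 CERTIFICATE v3 — SINGLE TOP OF RECORD**: the conjunction, BY NAME via `StatementOf`, of the v2 top `layer5_of_S_v2`
(`Conditional/Layer5OfSV02.lean`, p433973; through it v1/v0.1/v0 and the companion, all still available at their own strength) and this
module's `layer5_held_ex51v_v3` (Ex 5.1 (v), conjunct 1 at the genuine Kummer map, law (a) discharged), `layer5_held_sec2_v3_closureH`
(§2 rows at print's `Π̂_ℍ`) and the non-vacuity conjunct `layer5_nv_sec2_wholeGraph` (§2 binder set jointly realisable at `ℍ = 𝔾`).  CENSUS v3:
CONE 46 · FACT 0 · datum side-conditions 13 · NV 3.  S-FREE.  Nothing here asserts that abc is proved or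
refuted or takes a side on [IUTchIII] Cor. 3.12; a binder is an assumption label; typed ≠ discharged; indexed ≠ endorsed. -/
theorem layer5_of_S_v3 :
    Summit.ABC.IUTFork.DAG.PartL5a.StatementOf @layer5_of_S_v2 ∧
    Summit.ABC.IUTFork.DAG.PartL5a.StatementOf @layer5_held_ex51v_v3 ∧
    Summit.ABC.IUTFork.DAG.PartL5a.StatementOf @layer5_held_sec2_v3_closureH ∧
    Summit.ABC.IUTFork.DAG.PartL5a.StatementOf @layer5_nv_sec2_wholeGraph :=
  ⟨@layer5_of_S_v2, @layer5_held_ex51v_v3, @layer5_held_sec2_v3_closureH, @layer5_nv_sec2_wholeGraph⟩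

end Summit.ABC.IUTFork.Conditional

/-! ### Build-lane export guard (ops-buildfix bf1-g30, 2026-08-28; G11b-3 recipe v2 as in `GelbartRogawski1991/UnitaryDualPairSeesawCharacter`):
the theorems of this file carry very large dependent telescopes; at `.olean` export Lean 4.32's library-suggestion indexers fold over
every local theorem statement and do not finish within the build lane's one-hour clock (measured on a farm node: `lean -o` > 1 500 s, plain
elaboration ≈ 20 s). ONE file-final `local` `[implicit_reducible]` keeps them out of that premise index (inert for Meta and the kernel on
theorems; no definition is tagged; statements and proofs unchanged). -/
set_option allowUnsafeReducibility true in
attribute [local implicit_reducible]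
  _root_.Summit.ABC.IUTFork.Conditional.layer5_held_ex51v_v3
  _root_.Summit.ABC.IUTFork.Conditional.layer5_held_sec2_v3_closureH
  _root_.Summit.ABC.IUTFork.Conditional.layer5_nv_sec2_wholeGraph
  _root_.Summit.ABC.IUTFork.Conditional.layer5_of_S_v3
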